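import Mathlib
import HarnessLib
import Summits.HubbardSuperconductivity.HubbardSuperconductivity.Theorems.KLProgrammeKLRegimeTwoVolumeSrcBlockStepModel
import Summits.HubbardSuperconductivity.HubbardSuperconductivity.Theorems.KLProgrammeKLRegimeTwoVolumeSrcBlockStepTwoScale
import Summits.HubbardSuperconductivity.HubbardSuperconductivity.Theorems.KLProgrammeKLRegimeEngineTowerBlockIncrWtKitDict

/-!
# Route `KLProgramme` — crux K3, VL child `KLRegimeVolumeLimitV17F3` (stmt-HubbardSuperconductivity-23356), producer route «(VL)-SRC-SOFT» §S5a (model half):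
# THE SOURCE-SPECIES BLOCK STEP OF THE MODEL IN TWO-SCALE LAW-SHAPED CLOSED FORM WITH k-FREE CONSTANTS — the dictionary at the source geometry
# (fat family `F̃_k`, slice `(Λ_{k+1+ℓ}, Λ_{k+1}]`, thin family `F_{J′}`, units of level `k+1`) (seat hubbard-kl-k3c4-p1 g19; `--supports` 23356)

Composition of S3 (`klSrcPinnedSumAt_blockStep_le`, the model's door brackets for every cumulant order), S5a-abstract (`srcStep_le_twoScale_of_profile`) and E1's
dictionary identities (…TowerBlockIncrWtKitDict §1), at the block's own units `u = 8^{k+1}`, `Kc = 2^{−5(k+1)}` and field radius `ρ = θκ`: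

* §1 `towerDict_Phi_jump` (`(eα/κ²)·ε·2^{−5m} = 256·e·Cb·4^ℓ/Cκ` for `α = Cb(M/β)/Λ_{m+ℓ}`, `κ²8^m = 2Cκe₀` — E1's (D-Φ) at a jump of ANY length `ℓ`),
  `towerDict_cc_jump` (`ε·cc = 81·2^e·CJ′/2`);
* §2 **`klSrcPinnedSumAt_blockStep_le_twoScale`** — with the block data bound by the tree's EQUATIONS (`κ²·8^{k+1} = 2Cκe₀` — E1's `towerDict_sigma` for the fat level `k ≥ 1`, or any level-`0` Gram datum of that form —, `α = Cb(M/β)/Λ_{k+1+ℓ}`,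
  `cr = 81·CJ·M/β`, `cc = 81·2^{J′−k}·CJ′·M/β`), the species profiles `S s m` of the level-`k` datum (`s < 3`) carrying the two-scale law
  `S₀(2d) + tS₁(2d) + t²S₂(2d) ≤ 2^{−5(k+1)}·8^{(k+1)d}·(λ^{max(1,d−1)}(CQ^d + AR^d) + a[d=1])` (`d ≥ 1`), and the five rows of T2₂ at the CLOSED-FORM, k-FREE constants
  `σ = 2Cκe₀`, `τ = e⁴(1+θ)²·2Cκe₀`, `ψ = 1/(θ²·2Cκe₀)`, `Φ = 256·e·Cb·4^ℓ/Cκ`:  for every species `s < 3`, output degree `2(q+1)` and pin,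
  `klSrcPinnedSumAt … J′ r (k+1+ℓ) s (2(q+1)) p w″ ≤ t^{-s}·max(81CJ/2,1)·max(81·2^{J′−k}CJ′/2,1)^{2q+1}·[(S₀+tS₁+t²S₂)(2(q+1)) + 2^{−5(k+1)}8^{(k+1)(q+1)}·λ^q·((C+A)λ(4R)^{q+1}8σR +
  2e·ŵ·ζ·(2τψR)^{q+1})]` — the guard of S3 DERIVED from the `V`-row (`normV_le_towerV`, `towerV_units`, `towerV_le_twoScale`); no degree cap in the statement
  (`D := |SrcLabel|/2` internally; the closed form is `D`-free).
Compositions of landed theorems + real arithmetic; nothing about the model is asserted beyond them; nothing asserts any stub, VL, K3 or superconductivity.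
References: BGM 2006 §2.8 (2.77)–(2.83), §3 (3.2)–(3.8) [cite: BenfattoGiulianiMastropietro2006]; Gawȩdzki–Kupiainen 1985 §3 [cite: GawedzkiKupiainen1985GrossNeveu].
-/

noncomputable section

namespace Summit.HubbardSuperconductivity.HubbardSuperconductivity.Theorems.TwoVolumeDefect

set_option linter.dupNamespace false -- summit = problem name (single-conjunct summit), D-0017

open Real Finset Literature.MathematicalPhysics.QuantumLattice GrassmannAlgebra Literature.Probability.LatticeModels
open Literature.Probability.LatticeModels.BattleFederbush
open Summit.HubbardSuperconductivity.HubbardSuperconductivity.Theorems.KLProgrammeLegKernels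
open Summit.HubbardSuperconductivity.HubbardSuperconductivity.Theorems.KLRegimeSplit
open Summit.HubbardSuperconductivity.HubbardSuperconductivity.Theorems.EngineV8
open Summit.HubbardSuperconductivity.HubbardSuperconductivity.Theorems.TwoVolumeSource

/-! ## §1 Two dictionary identities at a jump of any length -/

/-- (D-Φ at any jump) `(eα/κ²)·(ε·2^{−5m}) = 256·e·Cb·4^ℓ/Cκ` for `α = Cb(M/β)/Λ_{m+ℓ}`, `κ²·8^m = 2Cκe₀`. -/
theorem towerDict_Phi_jump {Cκ Cb κ α β : ℝ} {M m ℓ : ℕ} (hCκ : 0 < Cκ) (hβ : 0 < β) (hM : 0 < (M : ℝ))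
    (hσ : κ ^ 2 * (8 : ℝ) ^ m = 2 * Cκ * klE0) (hα : α = Cb * ((M : ℝ) / β) / klScale klE0 (m + ℓ)) :
    Real.exp 1 * α / κ ^ 2 * (imagTimeWeight β M * ((2 : ℝ) ^ (5 * m))⁻¹) = 256 * Real.exp 1 * Cb * (4 : ℝ) ^ ℓ / Cκ := by
  have he : (0 : ℝ) < klE0 := by norm_num [klE0]
  have hκ2 : κ ^ 2 = 2 * Cκ * klE0 / (8 : ℝ) ^ m := by
    rw [eq_div_iff (pow_ne_zero _ (by norm_num))]; exact hσ
  have hΛ : klScale klE0 (m + ℓ) = klE0 * ((4 : ℝ) ^ (m + ℓ))⁻¹ := rfl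
  rw [hα, hκ2, hΛ, imagTimeWeight]
  unfold klE0
  rw [towerDict_eight_pow, towerDict_four_pow, towerDict_four_pow]
  have h2a : (2 : ℝ) ^ (2 * (m + ℓ)) = 2 ^ (2 * ℓ) * 2 ^ (2 * m) := by rw [← pow_add]; congr 1; ring
  rw [h2a]
  have hx : (2 : ℝ) ^ (2 * m) ≠ 0 := pow_ne_zero _ (by norm_num)
  have hy : (2 : ℝ) ^ (3 * m) ≠ 0 := pow_ne_zero _ (by norm_num)
  have hw : (2 : ℝ) ^ (2 * ℓ) ≠ 0 := pow_ne_zero _ (by norm_num)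
  have h5 : (2 : ℝ) ^ (5 * m) = 2 ^ (2 * m) * 2 ^ (3 * m) := by rw [← pow_add]; congr 1; ring
  rw [h5]
  field_simp
  ring

/-- (D-cc at any jump) `ε·cc = 81·2^e·CJ′/2` for `cc = 81·2^e·CJ′·M/β`, `ε = β/(2M)`. -/
theorem towerDict_cc_jump {β CJ' cc : ℝ} {M e : ℕ} (hβ : β ≠ 0) (hM : (M : ℝ) ≠ 0) (hcc : cc = 81 * (2 : ℝ) ^ e * CJ' * M / β) :
    imagTimeWeight β M * cc = 81 * (2 : ℝ) ^ e * CJ' / 2 := by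
  rw [hcc, imagTimeWeight]; field_simp

/-! ## §2 The model's source-species block step with k-free closed-form constants -/

variable {L M : ℕ} [NeZero L] [NeZero M]

open Classical in
/-- **THE SOURCE-SPECIES BLOCK STEP OF THE MODEL, TWO-SCALE LAW-SHAPED CLOSED FORM, k-FREE CONSTANTS** (see the module docstring).
[cite: BenfattoGiulianiMastropietro2006, §2.8 (2.77)-(2.83), §3 (3.2)-(3.8); cite: GawedzkiKupiainen1985GrossNeveu, §3] -/
theorem klSrcPinnedSumAt_blockStep_le_twoScale {β : ℝ} (hβ : 0 < β) (U μ : ℝ) (K : TrigPolyC4v) {k ℓ J' : ℕ}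
    (hJ' : k + 1 ≤ J') (r : ℕ)
    (hZ : hubbardEffPartitionFnCT L M β U μ 0 K (klScale klE0 (k + 1)) ≠ 0)
    {Cκ Cb CJ CJ' θ : ℝ} (hCκ : 0 < Cκ) (hCb : 0 < Cb) (hθ : 0 < θ)
    {κ α cr cc : ℝ} (hκ : 0 < κ) (hσ8 : κ ^ 2 * (8 : ℝ) ^ (k + 1) = 2 * Cκ * klE0)
    (hα : α = Cb * ((M : ℝ) / β) / klScale klE0 (k + 1 + ℓ))
    (hcr : cr = 81 * CJ * M / β) (hcc : cc = 81 * (2 : ℝ) ^ (J' - k) * CJ' * M / β)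
    (hGB : IsGramBoundedR ((sectorSubMatrix L M β (bgmFatMultiplier L M klE0 β (nambuXiCT L μ K) k)).transpose *
      hubbardCovSliceCT L M β μ 0 K (klScale klE0 (k + 1 + ℓ)) (klScale klE0 (k + 1)) *
        sectorSubMatrix L M β (bgmFatMultiplier L M klE0 β (nambuXiCT L μ K) k)) κ)
    (hrow : ∀ X, ∑ Y, ‖((sectorSubMatrix L M β (bgmFatMultiplier L M klE0 β (nambuXiCT L μ K) k)).transpose *
        hubbardCovSliceCT L M β μ 0 K (klScale klE0 (k + 1 + ℓ)) (klScale klE0 (k + 1)) *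
          sectorSubMatrix L M β (bgmFatMultiplier L M klE0 β (nambuXiCT L μ K) k)) X Y‖ *
        klScaleWt L M β r {latticeLegPos (2 * (2 * M)) X, latticeLegPos (2 * (2 * M)) Y} ≤ α)
    (hcol : ∀ Y, ∑ X, ‖((sectorSubMatrix L M β (bgmFatMultiplier L M klE0 β (nambuXiCT L μ K) k)).transpose *
        hubbardCovSliceCT L M β μ 0 K (klScale klE0 (k + 1 + ℓ)) (klScale klE0 (k + 1)) *
          sectorSubMatrix L M β (bgmFatMultiplier L M klE0 β (nambuXiCT L μ K) k)) X Y‖ *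
        klScaleWt L M β r {latticeLegPos (2 * (2 * M)) X, latticeLegPos (2 * (2 * M)) Y} ≤ α)
    (hrow' : ∀ X'', ∑ X', ‖(sectorAnalysisMatrix L M β (klAnisoFamily L M β μ K klE0 J') *
        sectorSubMatrix L M β (bgmFatMultiplier L M klE0 β (nambuXiCT L μ K) k)) X'' X'‖ *
        klScaleWt L M β r {latticeLegPos (2 * (2 * M)) X'', latticeLegPos (2 * (2 * M)) X'} ≤ cr)
    (hcol' : ∀ X', ∑ X'', ‖(sectorAnalysisMatrix L M β (klAnisoFamily L M β μ K klE0 J') *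
        sectorSubMatrix L M β (bgmFatMultiplier L M klE0 β (nambuXiCT L μ K) k)) X'' X'‖ *
        klScaleWt L M β r {latticeLegPos (2 * (2 * M)) X'', latticeLegPos (2 * (2 * M)) X'} ≤ cc)
    (S : ℕ → ℕ → ℝ) (hS0 : ∀ s m, 0 ≤ S s m)
    (hS : ∀ s, s < 3 → ∀ (m : ℕ) (q : Fin m) (w : SrcLabel L M k), klSrcPinnedSumAt L M β U μ K k r (k + 1) s m q w ≤ S s m)
    {t lam Q R C A a : ℝ} (ht : 0 < t) (hlam : 0 < lam) (hR : 0 < R) (hQ : 0 ≤ Q) (hQR : Q ≤ R) (hC : 0 ≤ C) (hA : 0 ≤ A) (ha : 0 ≤ a)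
    (hprof : ∀ d, 1 ≤ d → S 0 (2 * d) + t * S 1 (2 * d) + t ^ 2 * S 2 (2 * d) ≤
      ((2 : ℝ) ^ (5 * (k + 1)))⁻¹ * ((8 : ℝ) ^ (k + 1)) ^ d * (lam ^ max 1 (d - 1) * (C * Q ^ d + A * R ^ d) + (if d = 1 then a else 0)))
    -- T2₂'s rows at the closed-form, k-free constants
    (hx₂ : 2 * lam * (Real.exp 1 ^ 4 * (1 + θ) ^ 2 * (2 * Cκ * klE0)) * R ≤ 1)
    (hx₁ : 4 * (2 * Cκ * klE0) * lam * R ≤ 1 / 2)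
    (hx₃ : Real.exp 1 * (Real.exp 1 ^ 4 * (1 + θ) ^ 2 * (2 * Cκ * klE0)) * lam * R ≤ 1 / 2)
    (hw : (256 * Real.exp 1 * Cb * (4 : ℝ) ^ ℓ / Cκ) * (2 * (Real.exp 1 ^ 4 * (1 + θ) ^ 2 * (2 * Cκ * klE0)) * R *
      (lam * (C * Q / (2 * R) + A / 2) + (a / (2 * R) + C * (Q / R) ^ 2 + A))) ≤ 1 / 2)
    (hV : (256 * Real.exp 1 * Cb * (4 : ℝ) ^ ℓ / Cκ) *
      (Real.exp 1 * (Real.exp 1 ^ 4 * (1 + θ) ^ 2 * (2 * Cκ * klE0)) * (lam * (C * Q + A * R) + a) +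
        4 * lam * (Real.exp 1 * (Real.exp 1 ^ 4 * (1 + θ) ^ 2 * (2 * Cκ * klE0))) ^ 2 * (C * Q ^ 2 + A * R ^ 2)) ≤ 1 / 2)
    {s : ℕ} (hs : s < 3) (q : ℕ) (p : Fin (2 * (q + 1))) (w'' : SrcLabel L M J') :
    klSrcPinnedSumAt L M β U μ K J' r (k + 1 + ℓ) s (2 * (q + 1)) p w'' ≤
      t⁻¹ ^ s * (max (81 * CJ / 2) 1 * max (81 * (2 : ℝ) ^ (J' - k) * CJ' / 2) 1 ^ (2 * q + 1)) *
        ((S 0 (2 * (q + 1)) + t * S 1 (2 * (q + 1)) + t ^ 2 * S 2 (2 * (q + 1))) +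
          ((2 : ℝ) ^ (5 * (k + 1)))⁻¹ * ((8 : ℝ) ^ (k + 1)) ^ (q + 1) *
            (lam ^ q * ((C + A) * lam * ((4 * R) ^ (q + 1) * (8 * (2 * Cκ * klE0) * R)) +
              2 * Real.exp 1 * ((256 * Real.exp 1 * Cb * (4 : ℝ) ^ ℓ / Cκ) * (2 * (Real.exp 1 ^ 4 * (1 + θ) ^ 2 * (2 * Cκ * klE0)) * R *
                  (lam * (C * Q / (2 * R) + A / 2) + (a / (2 * R) + C * (Q / R) ^ 2 + A)))) *
                (lam * (C * Q / (2 * R) + A / 2) + (a / (2 * R) + C * (Q / R) ^ 2 + A)) *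
                (2 * (Real.exp 1 ^ 4 * (1 + θ) ^ 2 * (2 * Cκ * klE0)) * (1 / (θ ^ 2 * (2 * Cκ * klE0))) * R) ^ (q + 1)))) := by
  have hM0 : (0 : ℝ) < M := Nat.cast_pos.2 (Nat.pos_of_ne_zero (NeZero.ne M))
  have hε : 0 < imagTimeWeight β M := imagTimeWeight_pos_of_pos (M := M) hβ
  have he : (0 : ℝ) < klE0 := by norm_num [klE0]
  have hκpos : 0 < κ := hκ
  have hαpos : 0 < α := by
    rw [hα]; have := klth_klScale_pos (k + 1 + ℓ); positivity
  have hρ : 0 < θ * κ := mul_pos hθ hκpos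
  -- units
  set u : ℝ := (8 : ℝ) ^ (k + 1) with hu
  set Kc : ℝ := ((2 : ℝ) ^ (5 * (k + 1)))⁻¹ with hKc
  have hu0 : 0 < u := by rw [hu]; positivity
  have hKc0 : 0 < Kc := by rw [hKc]; positivity
  -- dictionary
  have hσ : κ ^ 2 * u = 2 * Cκ * klE0 := by rw [hu]; exact hσ8
  have hτ : (Real.exp 2 * (κ + θ * κ)) ^ 2 * u = Real.exp 1 ^ 4 * (1 + θ) ^ 2 * (2 * Cκ * klE0) := towerDict_tau hσ
  have hψ : (θ * κ)⁻¹ ^ 2 / u = 1 / (θ ^ 2 * (2 * Cκ * klE0)) := towerDict_psi hκpos hθ hσ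
  have hΦ : Real.exp 1 * α / κ ^ 2 * (imagTimeWeight β M * Kc) = 256 * Real.exp 1 * Cb * (4 : ℝ) ^ ℓ / Cκ := by
    rw [hKc]; exact towerDict_Phi_jump hCκ hβ hM0 (by rw [hu] at hσ; exact hσ) hα
  have hcr' : imagTimeWeight β M * cr = 81 * CJ / 2 := towerDict_cr hβ.ne' hM0.ne' hcr
  have hcc' : imagTimeWeight β M * cc = 81 * (2 : ℝ) ^ (J' - k) * CJ' / 2 := towerDict_cc_jump hβ.ne' hM0.ne' hcc
  -- the sizes with `S s 0 := 0` (degree zero carries no pin: `hS` is vacuous there) and the dimensionless array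
  set S' : ℕ → ℕ → ℝ := fun s' m => if m = 0 then 0 else S s' m with hS'def
  have hS'0 : ∀ s' m, 0 ≤ S' s' m := fun s' m => by
    simp only [hS'def]; split_ifs
    · exact le_rfl
    · exact hS0 s' m
  have hS'eq : ∀ s' m, m ≠ 0 → S' s' m = S s' m := fun s' m hm => by simp only [hS'def, if_neg hm]
  have hS'S : ∀ s', s' < 3 → ∀ (m : ℕ) (q' : Fin m) (w : SrcLabel L M k),
      klSrcPinnedSumAt L M β U μ K k r (k + 1) s' m q' w ≤ S' s' m := by
    intro s' hs' m q' w
    rcases Nat.eq_zero_or_pos m with hm | hm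
    · subst hm; exact absurd q'.2 (by omega)
    · rw [hS'eq s' m (by omega)]; exact hS s' hs' m q' w
  set μa : ℕ → ℝ := fun m' => (S' 0 (2 * m') + t * S' 1 (2 * m') + t ^ 2 * S' 2 (2 * m')) / (Kc * u ^ m') with hμa
  have hKu : ∀ m', Kc * u ^ m' ≠ 0 := fun m' => by positivity
  have hNt : ∀ m', imagTimeWeight β M * S' 0 (2 * m') + t * (imagTimeWeight β M * S' 1 (2 * m')) +
      t ^ 2 * (imagTimeWeight β M * S' 2 (2 * m')) = (imagTimeWeight β M * Kc) * (u ^ m' * μa m') := by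
    intro m'
    have h := hKu m'
    simp only [hμa]
    field_simp
  have hμ0 : ∀ m', 0 ≤ μa m' := fun m' => by
    simp only [hμa]
    have := hS'0 0 (2 * m'); have := hS'0 1 (2 * m'); have := hS'0 2 (2 * m')
    positivity
  have hμ00 : μa 0 = 0 := by simp [hμa, hS'def]
  set D : ℕ := Fintype.card (SrcLabel L M k) / 2 with hDdef
  have hprof' : ∀ d, 1 ≤ d → d ≤ D → μa d ≤ lam ^ max 1 (d - 1) * (C * Q ^ d + A * R ^ d) + (if d = 1 then a else 0) := by
    intro d hd _
    have h := hprof d hd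
    have hne : 2 * d ≠ 0 := by omega
    simp only [hμa, hS'eq _ _ hne]
    rw [div_le_iff₀ (by positivity)]
    calc S 0 (2 * d) + t * S 1 (2 * d) + t ^ 2 * S 2 (2 * d) ≤ _ := h
      _ = _ := by rw [hKc, hu]; ring
  -- the `V`-row gives S3's guard
  have hVb := towerV_le_twoScale (D := D) (μ := μa) (τ := Real.exp 1 ^ 4 * (1 + θ) ^ 2 * (2 * Cκ * klE0))
    (by positivity) hlam.le hR.le hQ hQR hC hA ha hμ0 hprof' hx₃
  have hV0 : 0 ≤ towerV D (Real.exp 1 ^ 4 * (1 + θ) ^ 2 * (2 * Cκ * klE0)) μa := towerV_nonneg (by positivity) hμ0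
  have hΦ0 : 0 ≤ 256 * Real.exp 1 * Cb * (4 : ℝ) ^ ℓ / Cκ := by positivity
  have hguard : (256 * Real.exp 1 * Cb * (4 : ℝ) ^ ℓ / Cκ) * towerV D (Real.exp 1 ^ 4 * (1 + θ) ^ 2 * (2 * Cκ * klE0)) μa < 1 := by
    have := mul_le_mul_of_nonneg_left hVb hΦ0
    linarith
  have hfun : (fun m' => imagTimeWeight β M * S' 0 (2 * m') + t * (imagTimeWeight β M * S' 1 (2 * m')) +
      t ^ 2 * (imagTimeWeight β M * S' 2 (2 * m'))) = fun m' => (imagTimeWeight β M * Kc) * (u ^ m' * μa m') := funext hNt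
  have hN0 : ∀ m', 0 ≤ (imagTimeWeight β M * Kc) * (u ^ m' * μa m') := fun m' => by have := hμ0 m'; positivity
  have hN00 : (imagTimeWeight β M * Kc) * (u ^ 0 * μa 0) = 0 := by rw [hμ00, mul_zero, mul_zero]
  have hθS3 : Real.exp 1 * α * normV (SrcLabel L M k) κ (θ * κ)
      (fun m' => imagTimeWeight β M * S' 0 (2 * m') + t * (imagTimeWeight β M * S' 1 (2 * m')) +
        t ^ 2 * (imagTimeWeight β M * S' 2 (2 * m'))) / κ ^ 2 < 1 := by
    rw [hfun]
    have hnV := normV_le_towerV (Γ := SrcLabel L M k) hκpos.le hρ.le (N := fun m' => (imagTimeWeight β M * Kc) * (u ^ m' * μa m'))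
      hN0 hN00 (D := D) le_rfl
    rw [towerV_units, hτ] at hnV
    have hc : 0 ≤ Real.exp 1 * α / κ ^ 2 := by positivity
    calc Real.exp 1 * α * normV (SrcLabel L M k) κ (θ * κ) (fun m' => (imagTimeWeight β M * Kc) * (u ^ m' * μa m')) / κ ^ 2
        = Real.exp 1 * α / κ ^ 2 * normV (SrcLabel L M k) κ (θ * κ) (fun m' => (imagTimeWeight β M * Kc) * (u ^ m' * μa m')) := by ring
      _ ≤ Real.exp 1 * α / κ ^ 2 * ((imagTimeWeight β M * Kc) * towerV D (Real.exp 1 ^ 4 * (1 + θ) ^ 2 * (2 * Cκ * klE0)) μa) :=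
          mul_le_mul_of_nonneg_left hnV hc
      _ = (256 * Real.exp 1 * Cb * (4 : ℝ) ^ ℓ / Cκ) * towerV D (Real.exp 1 ^ 4 * (1 + θ) ^ 2 * (2 * Cκ * klE0)) μa := by
          rw [← hΦ]; ring
      _ < 1 := hguard
  -- S3 for every cumulant order, in the abstract shape
  have hcr'0 : 0 ≤ max (81 * CJ / 2) 1 := zero_le_one.trans (le_max_right _ _)
  have hcc'0 : 0 ≤ max (81 * (2 : ℝ) ^ (J' - k) * CJ' / 2) 1 := zero_le_one.trans (le_max_right _ _)
  have hb : ∀ N₀ : ℕ, 2 ≤ N₀ →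
      imagTimeWeight β M * klSrcPinnedSumAt L M β U μ K J' r (k + 1 + ℓ) s (2 * (q + 1)) p w'' ≤
      t⁻¹ ^ s * (max (81 * CJ / 2) 1 * max (81 * (2 : ℝ) ^ (J' - k) * CJ' / 2) 1 ^ (2 * q + 1) *
        ((imagTimeWeight β M * Kc) * (u ^ (q + 1) * μa (q + 1)) +
         (∑ m' ∈ range (Fintype.card (SrcLabel L M k) / 2 + 1),
            if q + 1 < m' then ((2 * m').choose (2 * (q + 1)) : ℝ) * κ ^ (2 * m' - 2 * (q + 1)) *
              ((imagTimeWeight β M * Kc) * (u ^ m' * μa m')) else 0) +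
         (∑ n ∈ Ico 2 N₀, ((θ * κ)⁻¹ ^ (2 * (q + 1)) * κ⁻¹ ^ (2 * (n - 1)) * (α ^ (n - 1) * Real.exp n)) *
              ∑ δ ∈ (Fintype.piFinset fun _ : Fin n => range (Fintype.card (SrcLabel L M k) / 2 + 1)) with
                  2 * (q + 1) + 2 * (n - 1) ≤ ∑ a, 2 * δ a,
                ∏ a, (Real.exp 2 * (κ + θ * κ)) ^ (2 * δ a) * ((imagTimeWeight β M * Kc) * (u ^ (δ a) * μa (δ a))) +
            (θ * κ)⁻¹ ^ (2 * (q + 1)) * (Real.exp 1 * normV (SrcLabel L M k) κ (θ * κ)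
                (fun m' => (imagTimeWeight β M * Kc) * (u ^ m' * μa m'))) *
              (Real.exp 1 * α * normV (SrcLabel L M k) κ (θ * κ) (fun m' => (imagTimeWeight β M * Kc) * (u ^ m' * μa m')) / κ ^ 2) ^ (N₀ - 1) /
              (1 - Real.exp 1 * α * normV (SrcLabel L M k) κ (θ * κ) (fun m' => (imagTimeWeight β M * Kc) * (u ^ m' * μa m')) / κ ^ 2)))) := by
    intro N₀ hN₀
    have h3 := klSrcPinnedSumAt_blockStep_le (L := L) (M := M) hβ U μ K (k := k) (J₂ := k + 1 + ℓ) (J' := J') (by omega) hJ' r hZ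
      hκpos hGB hαpos hrow hcol S' hS'0 hS'S hrow' hcol' ht hρ hθS3 hN₀ hs q p w''
    rw [hcr', hcc'] at h3
    simp_rw [hNt] at h3
    exact h3
  -- S5a-abstract
  have key := srcStep_le_twoScale_of_profile (Γ := SrcLabel L M k) hκpos hρ hαpos.le hcr'0 hcc'0 ht hε hu0 hKc0 hlam hR hQ hQR hC hA ha
    hμ0 hμ00 (D := D) le_rfl hprof' s q hb
    (by rw [hτ]; exact hx₂) (by rw [hσ]; exact hx₁) (by rw [hτ]; exact hx₃) (by rw [hΦ, hτ]; exact hw) (by rw [hΦ, hτ]; exact hV)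
  rw [hσ, hτ, hψ, hΦ] at key
  -- back to the model's sizes
  have hμq : Kc * u ^ (q + 1) * μa (q + 1) = S 0 (2 * (q + 1)) + t * S 1 (2 * (q + 1)) + t ^ 2 * S 2 (2 * (q + 1)) := by
    have hne : 2 * (q + 1) ≠ 0 := by omega
    simp only [hμa, hS'eq _ _ hne]
    field_simp
  refine le_of_mul_le_mul_left (key.trans (le_of_eq ?_)) hε
  rw [← hμq]
  ring

end Summit.HubbardSuperconductivity.HubbardSuperconductivity.Theorems.TwoVolumeDefect

end
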